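/-
Copyright (c) 2026 the pub-hodgecm-mathlib formalisation cell (harness21).  Prover seat hodgecm-mathlib-K2E1-p09 (g5), Track B ∕ K2-LIT,
h413 = `stmt-HodgeConjecture-24833`, line `K2_E1_TraceFormulaBeta`, page «EIS-RANK-ONE», deal (R3u) of the dealer K2E1-plan (g4) 2026-09-04T06:39:24Z: the z-UNIFORM edition
of ★ p857911 B′ on compact `Kc ⊂ {1 < Re z}` — the `hdec` input of ★ (R6g-a)_two ∕ (R6g-b)_two — from the single archimedean binder `hφarch`.
-/
import Summits.HodgeConjecture.HodgeConjecture.Theorems.K2E1EisensteinMinusConstantTermBoundedLevelCMTwo     -- ★ p857911∕p857932 (this seat): editions A′∕B′, finite-level letter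
import Summits.HodgeConjecture.HodgeConjecture.Theorems.K2E1TruncatedEisensteinLocallyUniformCMTwo           -- ★ p857946 (this seat): (R6g-a)_two
import Summits.HodgeConjecture.HodgeConjecture.Theorems.K2E1FlatSectionLineLevelFamilyU2                   -- ★ (this seat, (R3u) generic half): ONE `𝔫`, ONE `N₂` for a family
import HarnessLib

/-!
# h413 ∕ Track B «K2-LIT», «EIS-RANK-ONE» (R3u) — `K2E1EisensteinMinusConstantTermBoundedLevelCMTwoUniform`:
# `∃ M₁, ∀ z ∈ Kc, ∀ g, T < H(g) → ‖E(f_z)(g) − E(f_z)_B(g)‖ ≤ M₁` on `U(1,1)` over a CM field, UNIFORMLY on compact `Kc ⊂ {1 < Re z}`, from `hφarch`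

Cell `pub/hodgecm-mathlib`, crux H413 = `stmt-HodgeConjecture-24833`, route `HCCMUnconditional`; dealer K2E1-plan (g4), deal (R3u) 2026-09-04T06:39:24Z («the z-UNIFORM edition of ★ p857911
B′ … constants depend on `z` only through `Re z`, `Cφ`, `m` … = exactly the `hdec` input of ★ (R6g-a)_two∕(R6g-b)_two»).  THEOREMS ONLY (no `def`, no `instance`, no `notation`, no
named-fact hypothesis, no `sorry`); lane `--kind proof --supports stmt-HodgeConjecture-24833 --as helper` (count-neutral).

THE POINT.  In ★ p857911 (editions A′∕B′) the bound `M₁` depends on the exponent `z` through exactly three doors: (a) the level ideal `𝔫` — but the tube-lemma witness of ★ p857884 depends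
only on the compact `K_U` and the open `U₀`, so ★ `K2E1FlatSectionLineLevelFamilyU2` §1 (same seat, same deal) pulls `∃ 𝔫` IN FRONT of the section `f` (`exists_levelIdeal_forall_forall_line_periodic_of_level_two`), whence ONE envelope pair
`(c, C_f)` ★ p857712 and ONE decay constant ★ p857643 for the whole family; (b) the mass bound `N₂` of the fibrewise majorants — ★ `…LevelFamilyU2` §2 is ★ p857884 §2 for a FAMILY with one
`N₂` (`exists_fibre_majorant_of_archSmooth_of_level_family`); (c) the line integral of the envelope `C_φ·H^{Re z}` — bounded on a compact `Kc` by the two extreme exponents,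
`H^σ ≤ H^{σ₁} + H^{σ₂}` (★ `rpow_le_rpow_add_rpow`) and ★ p857829 `exists_integrable_envelope_line_cm_two` at `σ₁ = min_{Kc} Re`, `σ₂ = max_{Kc} Re`
(`exists_integrable_envelope_line_uniform_cm_two`).  Hence (this file) §3 `exists_bound_sub_borelConstantTerm_level_cm_two_family` (edition A′ for a family, ONE `M₁` from ONE `N₂`; every per-`z`
binder of ★ p857628 re-derived inside as in ★ p857911) and §4 **`exists_bound_sub_borelConstantTerm_level_cm_two_uniform_of_archSmooth`** — edition B′ z-UNIFORM on compact `Kc` —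
with the 1-call corollary through ★ (R6g-a)_two **`exists_norm_truncation_flatSectionU_le_uniform_level_cm_two_of_archSmooth`**: `∃ M, ∀ z ∈ Kc, ∀ g, ‖Λ^T E(f_z)(g)‖ ≤ M`.
SAT-WITNESS (ruling «VAC-U» (3)): the structural binders are those of ★ p857911 — witnessed there by `exists_level_binders_cm_two` (`U₀ := GL₂(𝒪̂_L)`) — plus a compact `Kc ⊂ {1 < Re z}`
(a singleton) and `𝓕` with compact closure (★ `exists_isCompact_image_traceZeroFundamentalDomain_subset_two`).

HONEST LABEL.  Count-neutral helper; proves no printed statement; HC_CM is proved only modulo the 7 printed citations (2 remaining named inputs: hLiu418 =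
`stmt-HodgeConjecture-24832`, h413 = `stmt-HodgeConjecture-24833`) until rung 0 closes.  The archimedean binder `hφarch` (uniform on `Kc`) is NOT discharged here ([D5]).

## References
* [MoeglinWaldspurger1995] C. Mœglin, J.-L. Waldspurger, *Spectral decomposition and Eisenstein series* (1995), I.2.10–I.2.13, II.1.5–II.1.7, IV.2.
* [Garrett2018] P. Garrett, *Modern Analysis of Automorphic Forms by Example* 1 (2018), §2.8–§2.11, §12.2.
* [Arthur1980TraceFormulaII] J. Arthur, *A trace formula for reductive groups II*, Compositio Math. 40 (1980), §4.
-/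

set_option autoImplicit false
set_option linter.dupNamespace false  -- the mandated namespace repeats the summit's segment (`HodgeConjecture.HodgeConjecture`)

noncomputable section

open MeasureTheory Measure Filter Topology NumberField IsDedekindDomain MulAction Module Set
open Literature.NumberTheory.Automorphic Literature.NumberTheory.Automorphic.UnitaryGroup Literature.NumberTheory.GaloisRepresentations
open Summit.HodgeConjecture.HodgeConjecture.Cruxes.H413.K2E1BorelEisensteinU
open Summit.HodgeConjecture.HodgeConjecture.Cruxes.H413.K2E1EisensteinMinusConstantTermCuspBoundU2
open Summit.HodgeConjecture.HodgeConjecture.Cruxes.H413.K2E1FlatSectionLineRestrictionU2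
open Summit.HodgeConjecture.HodgeConjecture.Cruxes.H413.K2E1FlatSectionLineRestrictionArchU2
open Summit.HodgeConjecture.HodgeConjecture.Cruxes.H413.K2E1UnipotentHaarNormalisationU2
open Summit.HodgeConjecture.HodgeConjecture.Cruxes.H413.K2E1AdelicFourierEnvelope
open Summit.HodgeConjecture.HodgeConjecture.Cruxes.H413.K2E1AdelicFourierDecay
open Summit.HodgeConjecture.HodgeConjecture.Cruxes.H413.K2E1InfiniteAdeleFourierDecay
open Summit.HodgeConjecture.HodgeConjecture.Cruxes.H413.K2E1EisensteinAnalyticBinders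
open Summit.HodgeConjecture.HodgeConjecture.Cruxes.H413.K2E1BorelEisensteinGodementCMTwo
open Summit.HodgeConjecture.HodgeConjecture.Cruxes.H413.K2E1TruncatedEisensteinBoundedCMTwo
open Summit.HodgeConjecture.HodgeConjecture.Cruxes.H413.K2E1EisensteinMinusConstantTermBoundedCMTwo
open Summit.HodgeConjecture.HodgeConjecture.Cruxes.H413.K2E1EisensteinMinusConstantTermBoundedArchCMTwo
open Summit.HodgeConjecture.HodgeConjecture.Cruxes.H413.K2E1FlatSectionLineLevelU2
open Summit.HodgeConjecture.HodgeConjecture.Cruxes.H413.K2E1EisensteinMinusConstantTermBoundedLevelCMTwo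
open Summit.HodgeConjecture.HodgeConjecture.Cruxes.H413.K2E1TruncatedEisensteinLocallyUniformCMTwo
open Summit.HodgeConjecture.HodgeConjecture.Cruxes.H413.K2E1FlatSectionLineLevelFamilyU2
open NumberField.mixedEmbedding
-- `Classical` is needed to see the Mathlib normed-space instances on `mixedSpace` (note H5 of `AdelicGLnGlue`)
open scoped ENNReal NNReal Classical

namespace Summit.HodgeConjecture.HodgeConjecture.Cruxes.H413.K2E1EisensteinMinusConstantTermBoundedLevelCMTwoUniform


/-! ## §3 The CM pair: edition A′ for a FAMILY of exponents — ONE `M₁` from ONE `N₂` -/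

section CM

variable (L : Type) [Field L] [NumberField L] [IsCMField L]
  (hij : (((0 : Fin 2) : ℕ)) + 1 = ((1 : Fin 2) : ℕ)) (hN : 2 = 2 * ((0 : Fin 2) : ℕ) + 2)
  [MeasurableSpace (quasiSplit (↥(maximalRealSubfield L)) L (IsCMField.complexConj L) 2).Adelic] [BorelSpace (quasiSplit (↥(maximalRealSubfield L)) L (IsCMField.complexConj L) 2).Adelic]
  [MeasurableSpace (AdeleRing (𝓞 L) L)] [BorelSpace (AdeleRing (𝓞 L) L)]
  [MeasurableSpace (AdeleRing (𝓞 ↥(maximalRealSubfield L)) ↥(maximalRealSubfield L))] [BorelSpace (AdeleRing (𝓞 ↥(maximalRealSubfield L)) ↥(maximalRealSubfield L))]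
  [MeasurableSpace (InfiniteAdeleRing ↥(maximalRealSubfield L))] [BorelSpace (InfiniteAdeleRing ↥(maximalRealSubfield L))]
  [MeasurableSpace (FiniteAdeleRing (𝓞 ↥(maximalRealSubfield L)) ↥(maximalRealSubfield L))] [BorelSpace (FiniteAdeleRing (𝓞 ↥(maximalRealSubfield L)) ↥(maximalRealSubfield L))]

/-- **EDITION A′, FAMILY FORM**: for a set `Kc ⊂ {1 < Re z}` of exponents and fibrewise archimedean data (`hA`, `hdecArch`) with ONE mass bound `N₂` for all `z ∈ Kc`, `k ∈ K_U`, ONE `M₁` bounds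
`‖E(f_z)(g) − E(f_z)_B(g)‖` on `{T < H}` for every `z ∈ Kc` (the constants of ★ p857911 A′ depend on `z` only through `N₂`: ★ `…LevelFamilyU2` §1's `𝔫` is `z`-free, hence so are the envelope and decay
constants ★ p857712 ∕ ★ p857643). [cite: MoeglinWaldspurger1995, I.2.10–I.2.12, II.1.7] [cite: Garrett2018, §2.9] -/
theorem exists_bound_sub_borelConstantTerm_level_cm_two_family {δ : L} (hcδ : IsCMField.complexConj L δ = -δ) (hδ : δ ≠ 0)
    (ν : Measure ↥(adelicUnipotent ↥(maximalRealSubfield L) L (IsCMField.complexConj L) 2)) [ν.IsHaarMeasure]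
    {𝓕 : Set ↥(adelicUnipotent ↥(maximalRealSubfield L) L (IsCMField.complexConj L) 2)} (h𝓕 : IsFundamentalDomain ↥(rationalUnipotent ↥(maximalRealSubfield L) L (IsCMField.complexConj L) 2) 𝓕 ν)
    (h𝓕c : IsCompact (closure 𝓕))
    (μ : Measure (AdeleRing (𝓞 ↥(maximalRealSubfield L)) ↥(maximalRealSubfield L))) [μ.IsAddHaarMeasure]
    (μ₁ : Measure (InfiniteAdeleRing ↥(maximalRealSubfield L))) [μ₁.IsAddHaarMeasure] (μ₂ : Measure (FiniteAdeleRing (𝓞 ↥(maximalRealSubfield L)) ↥(maximalRealSubfield L))) [μ₂.IsAddHaarMeasure]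
    (χ : HeckeCharacter L) (hχ : χ.IsUnitary) {Kc : Set ℂ} (hKc1 : ∀ z ∈ Kc, 1 < z.re)
    {φ : (quasiSplit (↥(maximalRealSubfield L)) L (IsCMField.complexConj L) 2).Adelic → ℂ} (hφc : Continuous φ) {Mφ : ℝ} (hφM : ∀ x, ‖φ x‖ ≤ Mφ)
    (hφB : ∀ b ∈ borelU ((IsCMField.complexConj L : L ≃ₐ[↥(maximalRealSubfield L)] L) : L →+* L) ((StdForm.antidiagonal 2).over L), ∀ x : (quasiSplit (↥(maximalRealSubfield L)) L (IsCMField.complexConj L) 2).Adelic, φ ((quasiSplit (↥(maximalRealSubfield L)) L (IsCMField.complexConj L) 2).toAdelic b * x) = φ x)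
    (hf : ∀ z ∈ Kc, ∀ (b g : (quasiSplit (↥(maximalRealSubfield L)) L (IsCMField.complexConj L) 2).Adelic) (u : (AdeleRing (𝓞 L) L)ˣ),
      ((b.1 : GL (Fin 2) (AdeleRing (𝓞 L) L)) : Matrix (Fin 2) (Fin 2) (AdeleRing (𝓞 L) L)) 1 0 = 0 →
      (u : (AdeleRing (𝓞 L) L)) = ((b.1 : GL (Fin 2) (AdeleRing (𝓞 L) L)) : Matrix (Fin 2) (Fin 2) (AdeleRing (𝓞 L) L)) 0 0 →
        flatSectionU φ z (b * g) = ((χ u : ℂˣ) : ℂ) * ((ideleNorm u : ℝ) : ℂ) ^ z * flatSectionU φ z g)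
    {U₀ : Subgroup (GL (Fin 2) (FiniteAdeleRing (𝓞 L) L))} (hU₀o : IsOpen (U₀ : Set (GL (Fin 2) (FiniteAdeleRing (𝓞 L) L))))
    (hU₀K : U₀ ≤ glFiniteIntegralLevel 2 L)
    (hφU : ∀ u : (quasiSplit (↥(maximalRealSubfield L)) L (IsCMField.complexConj L) 2).Adelic, adelicVal ↥(maximalRealSubfield L) L (IsCMField.complexConj L) 2 ((StdForm.antidiagonal 2).over L) u ∈ U₀.map (GLn.ofFinite 2 L) → ∀ y : (quasiSplit (↥(maximalRealSubfield L)) L (IsCMField.complexConj L) 2).Adelic, φ (y * u) = φ y)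
    {T : ℝ≥0} (hT : 1 ≤ T) {m : ℕ} (hm : (finrank ℚ ↥(maximalRealSubfield L) : ℝ) < m)
    {A : ℂ → (quasiSplit (↥(maximalRealSubfield L)) L (IsCMField.complexConj L) 2).Adelic → FiniteAdeleRing (𝓞 ↥(maximalRealSubfield L)) ↥(maximalRealSubfield L) → ℝ} {N₂ : ℝ} (hN₂ : 0 ≤ N₂)
    (hA : ∀ z ∈ Kc, ∀ k ∈ ((standardMaximalCompactGL 2 L).comap (adelicVal ↥(maximalRealSubfield L) L (IsCMField.complexConj L) 2 ((StdForm.antidiagonal 2).over L)) : Subgroup (quasiSplit (↥(maximalRealSubfield L)) L (IsCMField.complexConj L) 2).Adelic), Integrable (A z k) μ₂ ∧ ∫ b, A z k b ∂μ₂ ≤ N₂)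
    (hdecArch : ∀ z ∈ Kc, ∀ k ∈ ((standardMaximalCompactGL 2 L).comap (adelicVal ↥(maximalRealSubfield L) L (IsCMField.complexConj L) 2 ((StdForm.antidiagonal 2).over L)) : Subgroup (quasiSplit (↥(maximalRealSubfield L)) L (IsCMField.complexConj L) 2).Adelic), ∀ (b : FiniteAdeleRing (𝓞 ↥(maximalRealSubfield L)) ↥(maximalRealSubfield L)) (y : InfiniteAdeleRing ↥(maximalRealSubfield L)),
      ‖∫ a, flatSectionU φ z (((quasiSplit (↥(maximalRealSubfield L)) L (IsCMField.complexConj L) 2).toAdelic (weylLongU ((IsCMField.complexConj L : L ≃ₐ[↥(maximalRealSubfield L)] L) : L →+* L) (rfl : ((StdForm.antidiagonal 2).over L) = ((StdForm.antidiagonal 2).over L)))) *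
          ((middleRootUnipotent hij hN (Multiplicative.ofAdd (traceZeroLine ↥(maximalRealSubfield L) L (IsCMField.complexConj L) hcδ hδ ((a, b) : AdeleRing (𝓞 ↥(maximalRealSubfield L)) ↥(maximalRealSubfield L)))) : ↥(adelicUnipotent ↥(maximalRealSubfield L) L (IsCMField.complexConj L) 2)) : (quasiSplit (↥(maximalRealSubfield L)) L (IsCMField.complexConj L) 2).Adelic) * k) *
        (adeleAddChar ↥(maximalRealSubfield L) (infiniteAdeleInl ↥(maximalRealSubfield L) (y * a)) : ℂ) ∂μ₁‖ ≤ A z k b * (1 + ‖InfiniteAdeleRing.ringEquiv_mixedSpace ↥(maximalRealSubfield L) y‖) ^ (-(m : ℝ))) :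
    ∃ M₁ : ℝ, ∀ z ∈ Kc, ∀ g : (quasiSplit (↥(maximalRealSubfield L)) L (IsCMField.complexConj L) 2).Adelic, T < borelHeight g →
      ‖eisensteinSeriesU (flatSectionU φ z) g - borelConstantTerm ν 𝓕 (eisensteinSeriesU (flatSectionU φ z)) g‖ ≤ M₁ := by
  classical
  -- the CM pair
  haveI : Algebra.IsQuadraticExtension ↥(maximalRealSubfield L) L := IsCMField.isQuadraticExtension L
  haveI : LocallyCompactSpace (AdeleRing (𝓞 L) L) := locallyCompactSpace_adeleRing' L
  have hc : (IsCMField.complexConj L) * (IsCMField.complexConj L) = 1 := AlgEquiv.ext fun x => IsCMField.complexConj_apply_apply L x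
  -- the compact `K_U`, Iwasawa, heights on `K_U`
  have hKc : IsCompact (((standardMaximalCompactGL 2 L).comap (adelicVal ↥(maximalRealSubfield L) L (IsCMField.complexConj L) 2 ((StdForm.antidiagonal 2).over L)) : Subgroup (quasiSplit (↥(maximalRealSubfield L)) L (IsCMField.complexConj L) 2).Adelic) : Set (quasiSplit (↥(maximalRealSubfield L)) L (IsCMField.complexConj L) 2).Adelic) := isCompact_comap_adelicVal_standardMaximalCompactGL
  have hIw' : ∀ g : (quasiSplit (↥(maximalRealSubfield L)) L (IsCMField.complexConj L) 2).Adelic, ∃ b ∈ borelAdelic ↥(maximalRealSubfield L) L (IsCMField.complexConj L) 2, ∃ k ∈ (((standardMaximalCompactGL 2 L).comap (adelicVal ↥(maximalRealSubfield L) L (IsCMField.complexConj L) 2 ((StdForm.antidiagonal 2).over L)) : Subgroup (quasiSplit (↥(maximalRealSubfield L)) L (IsCMField.complexConj L) 2).Adelic) : Set (quasiSplit (↥(maximalRealSubfield L)) L (IsCMField.complexConj L) 2).Adelic), g = b * k := fun g => by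
    obtain ⟨b, hb, k, hk, hg⟩ := exists_mem_borelAdelic_mul_mem_standardMaximalCompactGL_cm L g
    exact ⟨b, hb, k, Subgroup.mem_comap.2 hk, hg⟩
  have hIw := exists_chart_torus_of_borel_mul hij hN hcδ hδ hIw'
  have hK : ∀ k ∈ (((standardMaximalCompactGL 2 L).comap (adelicVal ↥(maximalRealSubfield L) L (IsCMField.complexConj L) 2 ((StdForm.antidiagonal 2).over L)) : Subgroup (quasiSplit (↥(maximalRealSubfield L)) L (IsCMField.complexConj L) 2).Adelic) : Set (quasiSplit (↥(maximalRealSubfield L)) L (IsCMField.complexConj L) 2).Adelic), (borelHeight k : ℝ) ≤ (T : ℝ) := fun k hk => by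
    rw [borelHeight_eq_one_of_mem_maximalCompact hk, NNReal.coe_one]; exact_mod_cast hT
  -- the fundamental domain
  haveI := locallyCompactSpace_traceZeroAdele (F := ↥(maximalRealSubfield L)) (E := L) (c := (IsCMField.complexConj L))
  obtain ⟨h𝓕₀, h𝓕top⟩ := measure_fundamentalDomain_ne_zero_and_lt_top_two hij hN hc (Measure.addHaar : Measure ↥(traceZeroAdele ↥(maximalRealSubfield L) L (IsCMField.complexConj L))) ν h𝓕
  -- ONE level `𝔫` for every section of the family (★ `…LevelFamilyU2` §1), then the envelope constants (★ p857712) and the decay constant (★ p857643), all `z`-free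
  obtain ⟨𝔫, h𝔫, hper⟩ := exists_levelIdeal_forall_forall_line_periodic_of_level_two hij hN hcδ hδ hKc hU₀o
  obtain ⟨cE, hcE, Cf, hCfc, henv⟩ := exists_envelope ↥(maximalRealSubfield L) μ μ₁ μ₂ h𝔫
  have hM0 : 0 ≤ cE * N₂ := mul_nonneg hcE.le hN₂
  have hmm : (m : ℝ) ≤ ((m : ℕ) : ℝ) := le_rfl
  obtain ⟨C, hC0, hdecay⟩ := exists_forall_tsum_indicator_norm_mul_le_rpow_neg ↥(maximalRealSubfield L) hM0 hCfc hm hmm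
  have hd : 0 < (finrank ℚ ↥(maximalRealSubfield L) : ℝ) := Nat.cast_pos.2 finrank_pos
  haveI := isInvInvariant_of_isHaarMeasure_two (F := ↥(maximalRealSubfield L)) (E := L) (c := IsCMField.complexConj L) ν
  refine ⟨(μ (adeleFundamentalDomain ↥(maximalRealSubfield L))).toReal⁻¹ * C, fun z hzK g hg => ?_⟩
  have hz : 1 < z.re := hKc1 z hzK
  -- letters: `f_z = flatSectionU φ z`
  have hfc : Continuous (flatSectionU φ z) := continuous_flatSectionU hφc z
  have hfm : Measurable (flatSectionU φ z) := hfc.measurable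
  have hfB := flatSectionU_toAdelic_mul hφB z
  have hfN : ∀ (n : ↥(adelicUnipotent ↥(maximalRealSubfield L) L (IsCMField.complexConj L) 2)) (y : (quasiSplit (↥(maximalRealSubfield L)) L (IsCMField.complexConj L) 2).Adelic),
      flatSectionU φ z ((n : (quasiSplit (↥(maximalRealSubfield L)) L (IsCMField.complexConj L) 2).Adelic) * y) = flatSectionU φ z y :=
    unipotent_mul_of_borelLaw χ z (hf z hzK)
  have hfU : ∀ u : (quasiSplit (↥(maximalRealSubfield L)) L (IsCMField.complexConj L) 2).Adelic, adelicVal ↥(maximalRealSubfield L) L (IsCMField.complexConj L) 2 ((StdForm.antidiagonal 2).over L) u ∈ U₀.map (GLn.ofFinite 2 L) →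
      ∀ y : (quasiSplit (↥(maximalRealSubfield L)) L (IsCMField.complexConj L) 2).Adelic, flatSectionU φ z (y * u) = flatSectionU φ z y := by
    intro u hu y
    obtain ⟨w, hw, hwu⟩ := Subgroup.mem_map.1 hu
    have hk : u ∈ ((standardMaximalCompactGL 2 L).comap (adelicVal ↥(maximalRealSubfield L) L (IsCMField.complexConj L) 2 ((StdForm.antidiagonal 2).over L)) : Subgroup (quasiSplit (↥(maximalRealSubfield L)) L (IsCMField.complexConj L) 2).Adelic) :=
      Subgroup.mem_comap.2 (by rw [← hwu]; exact glIntegralLevel_le_standardMaximalCompactGL (GLn.ofFinite_mem_glIntegralLevel (hU₀K hw)))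
    rw [flatSectionU_apply, flatSectionU_apply, hφU u hu y, borelHeight_mul_of_mem_comap_standardMaximalCompactGL hk y]
  -- Godement at the CM pair: the locally uniform majorant of the left Eisenstein terms of `f`
  have hmaj := fun y₀ : (quasiSplit (↥(maximalRealSubfield L)) L (IsCMField.complexConj L) 2).Adelic => exists_locallyUniform_majorant_flatSectionU_cm_two L hz hφM y₀
  have hcont : ∀ q : Quotient (orbitRel ↥(borelU ((IsCMField.complexConj L : L ≃ₐ[↥(maximalRealSubfield L)] L) : L →+* L) ((StdForm.antidiagonal 2).over L)) ↥(unitaryGroupOfForm ((IsCMField.complexConj L : L ≃ₐ[↥(maximalRealSubfield L)] L) : L →+* L) ((StdForm.antidiagonal 2).over L))),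
      Continuous fun y : (quasiSplit (↥(maximalRealSubfield L)) L (IsCMField.complexConj L) 2).Adelic => flatSectionU φ z ((quasiSplit (↥(maximalRealSubfield L)) L (IsCMField.complexConj L) 2).toAdelic (q.out : ↥(unitaryGroupOfForm ((IsCMField.complexConj L : L ≃ₐ[↥(maximalRealSubfield L)] L) : L →+* L) ((StdForm.antidiagonal 2).over L))) * y) :=
    fun q => hfc.comp (continuous_const.mul continuous_id)
  have hfin := fun g : (quasiSplit (↥(maximalRealSubfield L)) L (IsCMField.complexConj L) 2).Adelic => hfin_of_locallyUniformMajorant ν hfB hcont hmaj h𝓕c g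
  have hs := fun g : (quasiSplit (↥(maximalRealSubfield L)) L (IsCMField.complexConj L) 2).Adelic => (summable_eisensteinSeriesU_flatSectionU_cm_two L hz hφM g).of_norm
  -- the Poisson binders along the line (★ (D1-c) I) and the normalisation (★ (D1-a))
  have hΦc := fun g : (quasiSplit (↥(maximalRealSubfield L)) L (IsCMField.complexConj L) 2).Adelic => continuous_weylLong_mul_line_mul hij hN hcδ hδ hfc g
  have hΦi := fun g : (quasiSplit (↥(maximalRealSubfield L)) L (IsCMField.complexConj L) 2).Adelic => integrable_weylLong_mul_line_mul_two hij hN hcδ hδ μ ν hfm hfN hfB h𝓕 g (hfin g)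
  have hloc := fun (g : (quasiSplit (↥(maximalRealSubfield L)) L (IsCMField.complexConj L) 2).Adelic) (C₀ : Set (AdeleRing (𝓞 ↥(maximalRealSubfield L)) ↥(maximalRealSubfield L))) (hC₀ : IsCompact C₀) =>
    exists_summable_majorant_line_translate_two hij hN hcδ hδ hfB hmaj hC₀ g
  have hnorm := forall_inv_measure_smul_integral_weylLong_eq_two hij hN hcδ hδ hc μ ν h𝓕 (flatSectionU φ z)
  -- the archimedean binder ⟹ the decay class, for every `k ∈ K_U`
  have hσβ : 1 ≤ z.re + (m : ℝ) / (finrank ℚ ↥(maximalRealSubfield L) : ℝ) := le_add_of_le_of_nonneg hz.le (div_nonneg (Nat.cast_nonneg m) hd.le)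
  have hdec : ∀ k ∈ (((standardMaximalCompactGL 2 L).comap (adelicVal ↥(maximalRealSubfield L) L (IsCMField.complexConj L) 2 ((StdForm.antidiagonal 2).over L)) : Subgroup (quasiSplit (↥(maximalRealSubfield L)) L (IsCMField.complexConj L) 2).Adelic) : Set (quasiSplit (↥(maximalRealSubfield L)) L (IsCMField.complexConj L) 2).Adelic), ∀ Λ' : (AdeleRing (𝓞 ↥(maximalRealSubfield L)) ↥(maximalRealSubfield L))ˣ, 1 ≤ ((IdeleClassGroup.ideleNorm ↥(maximalRealSubfield L) Λ' : ℝ≥0) : ℝ) →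
      (Summable fun ξ : ↥(maximalRealSubfield L) => ‖∫ v, (fun x : AdeleRing (𝓞 ↥(maximalRealSubfield L)) ↥(maximalRealSubfield L) => flatSectionU φ z (((quasiSplit (↥(maximalRealSubfield L)) L (IsCMField.complexConj L) 2).toAdelic (weylLongU ((IsCMField.complexConj L : L ≃ₐ[↥(maximalRealSubfield L)] L) : L →+* L) (rfl : ((StdForm.antidiagonal 2).over L) = ((StdForm.antidiagonal 2).over L)))) *
          ((middleRootUnipotent hij hN (Multiplicative.ofAdd (traceZeroLine ↥(maximalRealSubfield L) L (IsCMField.complexConj L) hcδ hδ x)) : ↥(adelicUnipotent ↥(maximalRealSubfield L) L (IsCMField.complexConj L) 2)) : (quasiSplit (↥(maximalRealSubfield L)) L (IsCMField.complexConj L) 2).Adelic) * k)) v *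
        (adeleAddChar ↥(maximalRealSubfield L) (algebraMap ↥(maximalRealSubfield L) (AdeleRing (𝓞 ↥(maximalRealSubfield L)) ↥(maximalRealSubfield L)) ξ * (Λ' : AdeleRing (𝓞 ↥(maximalRealSubfield L)) ↥(maximalRealSubfield L)) * v) : ℂ) ∂μ‖) ∧
      ∑' ξ : ↥(maximalRealSubfield L), ({0}ᶜ : Set ↥(maximalRealSubfield L)).indicator (fun ξ => ‖∫ v, (fun x : AdeleRing (𝓞 ↥(maximalRealSubfield L)) ↥(maximalRealSubfield L) => flatSectionU φ z (((quasiSplit (↥(maximalRealSubfield L)) L (IsCMField.complexConj L) 2).toAdelic (weylLongU ((IsCMField.complexConj L : L ≃ₐ[↥(maximalRealSubfield L)] L) : L →+* L) (rfl : ((StdForm.antidiagonal 2).over L) = ((StdForm.antidiagonal 2).over L)))) *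
          ((middleRootUnipotent hij hN (Multiplicative.ofAdd (traceZeroLine ↥(maximalRealSubfield L) L (IsCMField.complexConj L) hcδ hδ x)) : ↥(adelicUnipotent ↥(maximalRealSubfield L) L (IsCMField.complexConj L) 2)) : (quasiSplit (↥(maximalRealSubfield L)) L (IsCMField.complexConj L) 2).Adelic) * k)) v *
        (adeleAddChar ↥(maximalRealSubfield L) (algebraMap ↥(maximalRealSubfield L) (AdeleRing (𝓞 ↥(maximalRealSubfield L)) ↥(maximalRealSubfield L)) ξ * (Λ' : AdeleRing (𝓞 ↥(maximalRealSubfield L)) ↥(maximalRealSubfield L)) * v) : ℂ) ∂μ‖) ξ ≤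
        C * ((IdeleClassGroup.ideleNorm ↥(maximalRealSubfield L) Λ' : ℝ≥0) : ℝ) ^ (-((m : ℝ) / (finrank ℚ ↥(maximalRealSubfield L) : ℝ))) := by
    intro k hk Λ' _
    set Φ : AdeleRing (𝓞 ↥(maximalRealSubfield L)) ↥(maximalRealSubfield L) → ℂ := fun x => flatSectionU φ z (((quasiSplit (↥(maximalRealSubfield L)) L (IsCMField.complexConj L) 2).toAdelic (weylLongU ((IsCMField.complexConj L : L ≃ₐ[↥(maximalRealSubfield L)] L) : L →+* L) (rfl : ((StdForm.antidiagonal 2).over L) = ((StdForm.antidiagonal 2).over L)))) *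
      ((middleRootUnipotent hij hN (Multiplicative.ofAdd (traceZeroLine ↥(maximalRealSubfield L) L (IsCMField.complexConj L) hcδ hδ x)) : ↥(adelicUnipotent ↥(maximalRealSubfield L) L (IsCMField.complexConj L) 2)) : (quasiSplit (↥(maximalRealSubfield L)) L (IsCMField.complexConj L) 2).Adelic) * k) with hΦ
    have hΦprod : Integrable (fun p : InfiniteAdeleRing ↥(maximalRealSubfield L) × FiniteAdeleRing (𝓞 ↥(maximalRealSubfield L)) ↥(maximalRealSubfield L) => Φ (p.1, p.2)) (μ₁.prod μ₂) :=
      (integrable_iff_integrable_prod ↥(maximalRealSubfield L) μ μ₁ μ₂ Φ).1 (hΦi k)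
    obtain ⟨hAk, hAN⟩ := hA z hzK k hk
    obtain ⟨hMΨ, hCfΨ⟩ := henv Φ (A z k) N₂ m hΦprod (fun a b l hl => hper (flatSectionU φ z) hfU k hk a b l hl) (fun b y => hdecArch z hzK k hk b y) hAk hAN
    exact hdecay (fun η => ∫ v, Φ v * (adeleAddChar ↥(maximalRealSubfield L) (η * v) : ℂ) ∂μ) hMΨ hCfΨ Λ'
  -- the cusp bound ★ p857628 at this `z`
  have hg' : (T : ℝ) < (borelHeight g : ℝ) := by exact_mod_cast hg
  exact forall_norm_sub_borelConstantTerm_le_two hij hN hcδ hδ ν χ hχ z hfm hfN hfB (hf z hzK) h𝓕 h𝓕₀ h𝓕top.ne μ hC0 hσβ hK hIw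
    hfin hs hΦc hΦi hloc hnorm hdec g hg'

/-! ## §4 (R3u) Edition B′, z-UNIFORM on a compact `Kc ⊂ {1 < Re z}` — the `hdec` input of ★ (R6g-a)_two ∕ (R6g-b)_two -/

omit [MeasurableSpace (InfiniteAdeleRing ↥(maximalRealSubfield L))] [BorelSpace (InfiniteAdeleRing ↥(maximalRealSubfield L))]
  [MeasurableSpace (FiniteAdeleRing (𝓞 ↥(maximalRealSubfield L)) ↥(maximalRealSubfield L))] [BorelSpace (FiniteAdeleRing (𝓞 ↥(maximalRealSubfield L)) ↥(maximalRealSubfield L))] in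
/-- **THE ENVELOPES `C_φ·H^{Re z}`, `z ∈ Kc` COMPACT, ARE INTEGRABLE ALONG THE LINE WITH ONE BOUND** (uniformly on `K_U`): `H^σ ≤ H^{σ₁} + H^{σ₂}` for `σ₁ ≤ σ ≤ σ₂` (★
`rpow_le_rpow_add_rpow`) with `σ₁ = min Re`, `σ₂ = max Re` over `Kc` and ★ `exists_integrable_envelope_line_cm_two` at `σ₁`, `σ₂`. [cite: MoeglinWaldspurger1995, II.1.5] [cite: Garrett2018, §2.8] -/
theorem exists_integrable_envelope_line_uniform_cm_two {δ : L} (hcδ : IsCMField.complexConj L δ = -δ) (hδ : δ ≠ 0)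
    (ν : Measure ↥(adelicUnipotent ↥(maximalRealSubfield L) L (IsCMField.complexConj L) 2)) [ν.IsHaarMeasure]
    {𝓕 : Set ↥(adelicUnipotent ↥(maximalRealSubfield L) L (IsCMField.complexConj L) 2)} (h𝓕 : IsFundamentalDomain ↥(rationalUnipotent ↥(maximalRealSubfield L) L (IsCMField.complexConj L) 2) 𝓕 ν)
    (h𝓕c : IsCompact (closure 𝓕))
    (μ : Measure (AdeleRing (𝓞 ↥(maximalRealSubfield L)) ↥(maximalRealSubfield L))) [μ.IsAddHaarMeasure] {Kc : Set ℂ} (hKc : IsCompact Kc) (hKc1 : ∀ z ∈ Kc, 1 < z.re) {Cφ : ℝ} (hCφ : 0 ≤ Cφ) :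
    ∃ N : ℝ, ∀ z ∈ Kc, ∀ k ∈ ((standardMaximalCompactGL 2 L).comap (adelicVal ↥(maximalRealSubfield L) L (IsCMField.complexConj L) 2 ((StdForm.antidiagonal 2).over L)) : Subgroup (quasiSplit (↥(maximalRealSubfield L)) L (IsCMField.complexConj L) 2).Adelic),
      Integrable (fun t : AdeleRing (𝓞 ↥(maximalRealSubfield L)) ↥(maximalRealSubfield L) => Cφ * (borelHeight (((quasiSplit (↥(maximalRealSubfield L)) L (IsCMField.complexConj L) 2).toAdelic (weylLongU ((IsCMField.complexConj L : L ≃ₐ[↥(maximalRealSubfield L)] L) : L →+* L) (rfl : ((StdForm.antidiagonal 2).over L) = ((StdForm.antidiagonal 2).over L)))) *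
          ((middleRootUnipotent hij hN (Multiplicative.ofAdd (traceZeroLine ↥(maximalRealSubfield L) L (IsCMField.complexConj L) hcδ hδ t)) : ↥(adelicUnipotent ↥(maximalRealSubfield L) L (IsCMField.complexConj L) 2)) : (quasiSplit (↥(maximalRealSubfield L)) L (IsCMField.complexConj L) 2).Adelic) * k) : ℝ) ^ z.re) μ ∧
      ∫ t, Cφ * (borelHeight (((quasiSplit (↥(maximalRealSubfield L)) L (IsCMField.complexConj L) 2).toAdelic (weylLongU ((IsCMField.complexConj L : L ≃ₐ[↥(maximalRealSubfield L)] L) : L →+* L) (rfl : ((StdForm.antidiagonal 2).over L) = ((StdForm.antidiagonal 2).over L)))) *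
          ((middleRootUnipotent hij hN (Multiplicative.ofAdd (traceZeroLine ↥(maximalRealSubfield L) L (IsCMField.complexConj L) hcδ hδ t)) : ↥(adelicUnipotent ↥(maximalRealSubfield L) L (IsCMField.complexConj L) 2)) : (quasiSplit (↥(maximalRealSubfield L)) L (IsCMField.complexConj L) 2).Adelic) * k) : ℝ) ^ z.re ∂μ ≤ N := by
  rcases Kc.eq_empty_or_nonempty with hKe | hKne
  · exact ⟨0, fun z hz => by simp [hKe] at hz⟩
  obtain ⟨z₁, hz₁, hmin⟩ := hKc.exists_isMinOn hKne Complex.continuous_re.continuousOn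
  obtain ⟨z₂, hz₂, hmax⟩ := hKc.exists_isMaxOn hKne Complex.continuous_re.continuousOn
  obtain ⟨N₁, hN₁⟩ := exists_integrable_envelope_line_cm_two L hij hN hcδ hδ ν h𝓕 h𝓕c μ (z := z₁) (hKc1 z₁ hz₁) hCφ
  obtain ⟨N₂, hN₂⟩ := exists_integrable_envelope_line_cm_two L hij hN hcδ hδ ν h𝓕 h𝓕c μ (z := z₂) (hKc1 z₂ hz₂) hCφ
  refine ⟨N₁ + N₂, fun z hz k hk => ?_⟩
  have h₁ : z₁.re ≤ z.re := hmin hz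
  have h₂ : z.re ≤ z₂.re := hmax hz
  obtain ⟨hi₁, hle₁⟩ := hN₁ k hk
  obtain ⟨hi₂, hle₂⟩ := hN₂ k hk
  have hdom : ∀ t : AdeleRing (𝓞 ↥(maximalRealSubfield L)) ↥(maximalRealSubfield L), ‖Cφ * (borelHeight (((quasiSplit (↥(maximalRealSubfield L)) L (IsCMField.complexConj L) 2).toAdelic (weylLongU ((IsCMField.complexConj L : L ≃ₐ[↥(maximalRealSubfield L)] L) : L →+* L) (rfl : ((StdForm.antidiagonal 2).over L) = ((StdForm.antidiagonal 2).over L)))) *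
      ((middleRootUnipotent hij hN (Multiplicative.ofAdd (traceZeroLine ↥(maximalRealSubfield L) L (IsCMField.complexConj L) hcδ hδ t)) : ↥(adelicUnipotent ↥(maximalRealSubfield L) L (IsCMField.complexConj L) 2)) : (quasiSplit (↥(maximalRealSubfield L)) L (IsCMField.complexConj L) 2).Adelic) * k) : ℝ) ^ z.re‖ ≤ Cφ * (borelHeight (((quasiSplit (↥(maximalRealSubfield L)) L (IsCMField.complexConj L) 2).toAdelic (weylLongU ((IsCMField.complexConj L : L ≃ₐ[↥(maximalRealSubfield L)] L) : L →+* L) (rfl : ((StdForm.antidiagonal 2).over L) = ((StdForm.antidiagonal 2).over L)))) *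
      ((middleRootUnipotent hij hN (Multiplicative.ofAdd (traceZeroLine ↥(maximalRealSubfield L) L (IsCMField.complexConj L) hcδ hδ t)) : ↥(adelicUnipotent ↥(maximalRealSubfield L) L (IsCMField.complexConj L) 2)) : (quasiSplit (↥(maximalRealSubfield L)) L (IsCMField.complexConj L) 2).Adelic) * k) : ℝ) ^ z₁.re + Cφ * (borelHeight (((quasiSplit (↥(maximalRealSubfield L)) L (IsCMField.complexConj L) 2).toAdelic (weylLongU ((IsCMField.complexConj L : L ≃ₐ[↥(maximalRealSubfield L)] L) : L →+* L) (rfl : ((StdForm.antidiagonal 2).over L) = ((StdForm.antidiagonal 2).over L)))) *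
      ((middleRootUnipotent hij hN (Multiplicative.ofAdd (traceZeroLine ↥(maximalRealSubfield L) L (IsCMField.complexConj L) hcδ hδ t)) : ↥(adelicUnipotent ↥(maximalRealSubfield L) L (IsCMField.complexConj L) 2)) : (quasiSplit (↥(maximalRealSubfield L)) L (IsCMField.complexConj L) 2).Adelic) * k) : ℝ) ^ z₂.re := fun t => by
    rw [Real.norm_of_nonneg (mul_nonneg hCφ (Real.rpow_nonneg (NNReal.coe_nonneg _) _)), ← mul_add]
    exact mul_le_mul_of_nonneg_left (K2E1BorelEisensteinRegularCMThree.rpow_le_rpow_add_rpow (by exact_mod_cast borelHeight_pos _) h₁ h₂) hCφ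
  have hcont : Continuous fun t : AdeleRing (𝓞 ↥(maximalRealSubfield L)) ↥(maximalRealSubfield L) => flatSectionU (fun _ : (quasiSplit (↥(maximalRealSubfield L)) L (IsCMField.complexConj L) 2).Adelic => (1 : ℂ)) z (((quasiSplit (↥(maximalRealSubfield L)) L (IsCMField.complexConj L) 2).toAdelic (weylLongU ((IsCMField.complexConj L : L ≃ₐ[↥(maximalRealSubfield L)] L) : L →+* L) (rfl : ((StdForm.antidiagonal 2).over L) = ((StdForm.antidiagonal 2).over L)))) *
      ((middleRootUnipotent hij hN (Multiplicative.ofAdd (traceZeroLine ↥(maximalRealSubfield L) L (IsCMField.complexConj L) hcδ hδ t)) : ↥(adelicUnipotent ↥(maximalRealSubfield L) L (IsCMField.complexConj L) 2)) : (quasiSplit (↥(maximalRealSubfield L)) L (IsCMField.complexConj L) 2).Adelic) * k) :=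
    continuous_weylLong_mul_line_mul hij hN hcδ hδ (continuous_flatSectionU continuous_const z) k
  have hmeas : AEStronglyMeasurable (fun t : AdeleRing (𝓞 ↥(maximalRealSubfield L)) ↥(maximalRealSubfield L) => Cφ * (borelHeight (((quasiSplit (↥(maximalRealSubfield L)) L (IsCMField.complexConj L) 2).toAdelic (weylLongU ((IsCMField.complexConj L : L ≃ₐ[↥(maximalRealSubfield L)] L) : L →+* L) (rfl : ((StdForm.antidiagonal 2).over L) = ((StdForm.antidiagonal 2).over L)))) *
      ((middleRootUnipotent hij hN (Multiplicative.ofAdd (traceZeroLine ↥(maximalRealSubfield L) L (IsCMField.complexConj L) hcδ hδ t)) : ↥(adelicUnipotent ↥(maximalRealSubfield L) L (IsCMField.complexConj L) 2)) : (quasiSplit (↥(maximalRealSubfield L)) L (IsCMField.complexConj L) 2).Adelic) * k) : ℝ) ^ z.re) μ :=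
    (hcont.norm.const_mul Cφ).aestronglyMeasurable.congr (Eventually.of_forall fun t => by
      simp only [norm_flatSectionU, norm_one, one_mul])
  have hint : Integrable (fun t : AdeleRing (𝓞 ↥(maximalRealSubfield L)) ↥(maximalRealSubfield L) => Cφ * (borelHeight (((quasiSplit (↥(maximalRealSubfield L)) L (IsCMField.complexConj L) 2).toAdelic (weylLongU ((IsCMField.complexConj L : L ≃ₐ[↥(maximalRealSubfield L)] L) : L →+* L) (rfl : ((StdForm.antidiagonal 2).over L) = ((StdForm.antidiagonal 2).over L)))) *
      ((middleRootUnipotent hij hN (Multiplicative.ofAdd (traceZeroLine ↥(maximalRealSubfield L) L (IsCMField.complexConj L) hcδ hδ t)) : ↥(adelicUnipotent ↥(maximalRealSubfield L) L (IsCMField.complexConj L) 2)) : (quasiSplit (↥(maximalRealSubfield L)) L (IsCMField.complexConj L) 2).Adelic) * k) : ℝ) ^ z.re) μ := (hi₁.add hi₂).mono' hmeas (Eventually.of_forall hdom)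
  refine ⟨hint, ?_⟩
  calc ∫ t, Cφ * (borelHeight (((quasiSplit (↥(maximalRealSubfield L)) L (IsCMField.complexConj L) 2).toAdelic (weylLongU ((IsCMField.complexConj L : L ≃ₐ[↥(maximalRealSubfield L)] L) : L →+* L) (rfl : ((StdForm.antidiagonal 2).over L) = ((StdForm.antidiagonal 2).over L)))) *
          ((middleRootUnipotent hij hN (Multiplicative.ofAdd (traceZeroLine ↥(maximalRealSubfield L) L (IsCMField.complexConj L) hcδ hδ t)) : ↥(adelicUnipotent ↥(maximalRealSubfield L) L (IsCMField.complexConj L) 2)) : (quasiSplit (↥(maximalRealSubfield L)) L (IsCMField.complexConj L) 2).Adelic) * k) : ℝ) ^ z.re ∂μ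
      ≤ ∫ t, (Cφ * (borelHeight (((quasiSplit (↥(maximalRealSubfield L)) L (IsCMField.complexConj L) 2).toAdelic (weylLongU ((IsCMField.complexConj L : L ≃ₐ[↥(maximalRealSubfield L)] L) : L →+* L) (rfl : ((StdForm.antidiagonal 2).over L) = ((StdForm.antidiagonal 2).over L)))) *
          ((middleRootUnipotent hij hN (Multiplicative.ofAdd (traceZeroLine ↥(maximalRealSubfield L) L (IsCMField.complexConj L) hcδ hδ t)) : ↥(adelicUnipotent ↥(maximalRealSubfield L) L (IsCMField.complexConj L) 2)) : (quasiSplit (↥(maximalRealSubfield L)) L (IsCMField.complexConj L) 2).Adelic) * k) : ℝ) ^ z₁.re + Cφ * (borelHeight (((quasiSplit (↥(maximalRealSubfield L)) L (IsCMField.complexConj L) 2).toAdelic (weylLongU ((IsCMField.complexConj L : L ≃ₐ[↥(maximalRealSubfield L)] L) : L →+* L) (rfl : ((StdForm.antidiagonal 2).over L) = ((StdForm.antidiagonal 2).over L)))) *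
          ((middleRootUnipotent hij hN (Multiplicative.ofAdd (traceZeroLine ↥(maximalRealSubfield L) L (IsCMField.complexConj L) hcδ hδ t)) : ↥(adelicUnipotent ↥(maximalRealSubfield L) L (IsCMField.complexConj L) 2)) : (quasiSplit (↥(maximalRealSubfield L)) L (IsCMField.complexConj L) 2).Adelic) * k) : ℝ) ^ z₂.re) ∂μ :=
        integral_mono hint (hi₁.add hi₂) fun t => (Real.le_norm_self _).trans (hdom t)
    _ = _ := integral_add hi₁ hi₂
    _ ≤ N₁ + N₂ := add_le_add hle₁ hle₂

/-- **(R3u) EDITION B′, z-UNIFORM ON A COMPACT `Kc ⊂ {1 < Re z}`** — `∃ M₁, ∀ z ∈ Kc, ∀ g, T < H(g) → ‖E(f_z)(g) − E(f_z)_B(g)‖ ≤ M₁` for the CM pair, `φ` continuous bounded left-`B(L⁺)`-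
invariant right-invariant under the FINITE level `{1} × U₀` (`U₀ ≤ GL₂(𝒪̂_L)` open), section law `hf` for every `z ∈ Kc`, and the SINGLE archimedean binder `hφarch` for all `z ∈ Kc` with ONE
constant `C_φ` (envelope `C_φ·H^{Re z}`, `m > [L⁺:ℚ]`) — §3 ∘ ★ `…LevelFamilyU2` §2 ∘ `exists_integrable_envelope_line_uniform_cm_two`.  This is the `hdec` input of ★ (R6g-a)_two
`exists_norm_truncation_eisensteinSeriesU_flatSectionU_le_uniform_cm_two` ∕ ★ (R6g-b)_two `maassSelberg_diagonal_flatSectionU_cm_two`. [cite: MoeglinWaldspurger1995, I.2.10–I.2.12, IV.2]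
[cite: Garrett2018, §2.9] -/
theorem exists_bound_sub_borelConstantTerm_level_cm_two_uniform_of_archSmooth {δ : L} (hcδ : IsCMField.complexConj L δ = -δ) (hδ : δ ≠ 0)
    (ν : Measure ↥(adelicUnipotent ↥(maximalRealSubfield L) L (IsCMField.complexConj L) 2)) [ν.IsHaarMeasure]
    {𝓕 : Set ↥(adelicUnipotent ↥(maximalRealSubfield L) L (IsCMField.complexConj L) 2)} (h𝓕 : IsFundamentalDomain ↥(rationalUnipotent ↥(maximalRealSubfield L) L (IsCMField.complexConj L) 2) 𝓕 ν)
    (h𝓕c : IsCompact (closure 𝓕))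
    (μ : Measure (AdeleRing (𝓞 ↥(maximalRealSubfield L)) ↥(maximalRealSubfield L))) [μ.IsAddHaarMeasure]
    (μ₁ : Measure (InfiniteAdeleRing ↥(maximalRealSubfield L))) [μ₁.IsAddHaarMeasure] (μ₂ : Measure (FiniteAdeleRing (𝓞 ↥(maximalRealSubfield L)) ↥(maximalRealSubfield L))) [μ₂.IsAddHaarMeasure]
    (χ : HeckeCharacter L) (hχ : χ.IsUnitary) {Kc : Set ℂ} (hKc : IsCompact Kc) (hKc1 : ∀ z ∈ Kc, 1 < z.re)
    {φ : (quasiSplit (↥(maximalRealSubfield L)) L (IsCMField.complexConj L) 2).Adelic → ℂ} (hφc : Continuous φ) {Mφ : ℝ} (hφM : ∀ x, ‖φ x‖ ≤ Mφ)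
    (hφB : ∀ b ∈ borelU ((IsCMField.complexConj L : L ≃ₐ[↥(maximalRealSubfield L)] L) : L →+* L) ((StdForm.antidiagonal 2).over L), ∀ x : (quasiSplit (↥(maximalRealSubfield L)) L (IsCMField.complexConj L) 2).Adelic, φ ((quasiSplit (↥(maximalRealSubfield L)) L (IsCMField.complexConj L) 2).toAdelic b * x) = φ x)
    (hf : ∀ z ∈ Kc, ∀ (b g : (quasiSplit (↥(maximalRealSubfield L)) L (IsCMField.complexConj L) 2).Adelic) (u : (AdeleRing (𝓞 L) L)ˣ),
      ((b.1 : GL (Fin 2) (AdeleRing (𝓞 L) L)) : Matrix (Fin 2) (Fin 2) (AdeleRing (𝓞 L) L)) 1 0 = 0 →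
      (u : (AdeleRing (𝓞 L) L)) = ((b.1 : GL (Fin 2) (AdeleRing (𝓞 L) L)) : Matrix (Fin 2) (Fin 2) (AdeleRing (𝓞 L) L)) 0 0 →
        flatSectionU φ z (b * g) = ((χ u : ℂˣ) : ℂ) * ((ideleNorm u : ℝ) : ℂ) ^ z * flatSectionU φ z g)
    {U₀ : Subgroup (GL (Fin 2) (FiniteAdeleRing (𝓞 L) L))} (hU₀o : IsOpen (U₀ : Set (GL (Fin 2) (FiniteAdeleRing (𝓞 L) L))))
    (hU₀K : U₀ ≤ glFiniteIntegralLevel 2 L)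
    (hφU : ∀ u : (quasiSplit (↥(maximalRealSubfield L)) L (IsCMField.complexConj L) 2).Adelic, adelicVal ↥(maximalRealSubfield L) L (IsCMField.complexConj L) 2 ((StdForm.antidiagonal 2).over L) u ∈ U₀.map (GLn.ofFinite 2 L) → ∀ y : (quasiSplit (↥(maximalRealSubfield L)) L (IsCMField.complexConj L) 2).Adelic, φ (y * u) = φ y)
    {T : ℝ≥0} (hT : 1 ≤ T) {m : ℕ} (hm : (finrank ℚ ↥(maximalRealSubfield L) : ℝ) < m) {Cφ : ℝ} (hCφ : 0 ≤ Cφ)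
    (hφarch : ∀ z ∈ Kc, ∀ k ∈ ((standardMaximalCompactGL 2 L).comap (adelicVal ↥(maximalRealSubfield L) L (IsCMField.complexConj L) 2 ((StdForm.antidiagonal 2).over L)) : Subgroup (quasiSplit (↥(maximalRealSubfield L)) L (IsCMField.complexConj L) 2).Adelic), ∀ b : FiniteAdeleRing (𝓞 ↥(maximalRealSubfield L)) ↥(maximalRealSubfield L),
      ContDiff ℝ m ((fun a : InfiniteAdeleRing ↥(maximalRealSubfield L) => flatSectionU φ z (((quasiSplit (↥(maximalRealSubfield L)) L (IsCMField.complexConj L) 2).toAdelic (weylLongU ((IsCMField.complexConj L : L ≃ₐ[↥(maximalRealSubfield L)] L) : L →+* L) (rfl : ((StdForm.antidiagonal 2).over L) = ((StdForm.antidiagonal 2).over L)))) *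
          ((middleRootUnipotent hij hN (Multiplicative.ofAdd (traceZeroLine ↥(maximalRealSubfield L) L (IsCMField.complexConj L) hcδ hδ ((a, b) : AdeleRing (𝓞 ↥(maximalRealSubfield L)) ↥(maximalRealSubfield L)))) : ↥(adelicUnipotent ↥(maximalRealSubfield L) L (IsCMField.complexConj L) 2)) : (quasiSplit (↥(maximalRealSubfield L)) L (IsCMField.complexConj L) 2).Adelic) * k)) ∘ (InfiniteAdeleRing.ringEquiv_mixedSpace ↥(maximalRealSubfield L)).symm) ∧
      ∀ j : ℕ, j ≤ m → ∀ s : mixedSpace ↥(maximalRealSubfield L),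
        ‖iteratedFDeriv ℝ j ((fun a : InfiniteAdeleRing ↥(maximalRealSubfield L) => flatSectionU φ z (((quasiSplit (↥(maximalRealSubfield L)) L (IsCMField.complexConj L) 2).toAdelic (weylLongU ((IsCMField.complexConj L : L ≃ₐ[↥(maximalRealSubfield L)] L) : L →+* L) (rfl : ((StdForm.antidiagonal 2).over L) = ((StdForm.antidiagonal 2).over L)))) *
          ((middleRootUnipotent hij hN (Multiplicative.ofAdd (traceZeroLine ↥(maximalRealSubfield L) L (IsCMField.complexConj L) hcδ hδ ((a, b) : AdeleRing (𝓞 ↥(maximalRealSubfield L)) ↥(maximalRealSubfield L)))) : ↥(adelicUnipotent ↥(maximalRealSubfield L) L (IsCMField.complexConj L) 2)) : (quasiSplit (↥(maximalRealSubfield L)) L (IsCMField.complexConj L) 2).Adelic) * k)) ∘ (InfiniteAdeleRing.ringEquiv_mixedSpace ↥(maximalRealSubfield L)).symm) s‖ ≤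
          Cφ * (borelHeight (((quasiSplit (↥(maximalRealSubfield L)) L (IsCMField.complexConj L) 2).toAdelic (weylLongU ((IsCMField.complexConj L : L ≃ₐ[↥(maximalRealSubfield L)] L) : L →+* L) (rfl : ((StdForm.antidiagonal 2).over L) = ((StdForm.antidiagonal 2).over L)))) *
          ((middleRootUnipotent hij hN (Multiplicative.ofAdd (traceZeroLine ↥(maximalRealSubfield L) L (IsCMField.complexConj L) hcδ hδ (((InfiniteAdeleRing.ringEquiv_mixedSpace ↥(maximalRealSubfield L)).symm s, b) : AdeleRing (𝓞 ↥(maximalRealSubfield L)) ↥(maximalRealSubfield L)))) : ↥(adelicUnipotent ↥(maximalRealSubfield L) L (IsCMField.complexConj L) 2)) : (quasiSplit (↥(maximalRealSubfield L)) L (IsCMField.complexConj L) 2).Adelic) * k) : ℝ) ^ z.re) :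
    ∃ M₁ : ℝ, ∀ z ∈ Kc, ∀ g : (quasiSplit (↥(maximalRealSubfield L)) L (IsCMField.complexConj L) 2).Adelic, T < borelHeight g →
      ‖eisensteinSeriesU (flatSectionU φ z) g - borelConstantTerm ν 𝓕 (eisensteinSeriesU (flatSectionU φ z)) g‖ ≤ M₁ := by
  haveI : Algebra.IsQuadraticExtension ↥(maximalRealSubfield L) L := IsCMField.isQuadraticExtension L
  have hKUc : IsCompact (((standardMaximalCompactGL 2 L).comap (adelicVal ↥(maximalRealSubfield L) L (IsCMField.complexConj L) 2 ((StdForm.antidiagonal 2).over L)) : Subgroup (quasiSplit (↥(maximalRealSubfield L)) L (IsCMField.complexConj L) 2).Adelic) : Set (quasiSplit (↥(maximalRealSubfield L)) L (IsCMField.complexConj L) 2).Adelic) := isCompact_comap_adelicVal_standardMaximalCompactGL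
  have h𝓔U : ∀ z ∈ Kc, ∀ u : (quasiSplit (↥(maximalRealSubfield L)) L (IsCMField.complexConj L) 2).Adelic, adelicVal ↥(maximalRealSubfield L) L (IsCMField.complexConj L) 2 ((StdForm.antidiagonal 2).over L) u ∈ U₀.map (GLn.ofFinite 2 L) → ∀ y : (quasiSplit (↥(maximalRealSubfield L)) L (IsCMField.complexConj L) 2).Adelic,
      (fun (z : ℂ) (y : (quasiSplit (↥(maximalRealSubfield L)) L (IsCMField.complexConj L) 2).Adelic) => Cφ * (borelHeight y : ℝ) ^ z.re) z (y * u) = (fun (z : ℂ) (y : (quasiSplit (↥(maximalRealSubfield L)) L (IsCMField.complexConj L) 2).Adelic) => Cφ * (borelHeight y : ℝ) ^ z.re) z y := by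
    intro z _ u hu y
    obtain ⟨w, hw, hwu⟩ := Subgroup.mem_map.1 hu
    have hk : u ∈ ((standardMaximalCompactGL 2 L).comap (adelicVal ↥(maximalRealSubfield L) L (IsCMField.complexConj L) 2 ((StdForm.antidiagonal 2).over L)) : Subgroup (quasiSplit (↥(maximalRealSubfield L)) L (IsCMField.complexConj L) 2).Adelic) :=
      Subgroup.mem_comap.2 (by rw [← hwu]; exact glIntegralLevel_le_standardMaximalCompactGL (GLn.ofFinite_mem_glIntegralLevel (hU₀K hw)))
    simp only [borelHeight_mul_of_mem_comap_standardMaximalCompactGL hk y]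
  obtain ⟨N, hN'⟩ := exists_integrable_envelope_line_uniform_cm_two L hij hN hcδ hδ ν h𝓕 h𝓕c μ hKc hKc1 hCφ
  obtain ⟨A, N₂, hN₂, hA, hdecArch⟩ := exists_fibre_majorant_of_archSmooth_of_level_family (f := fun z : ℂ => flatSectionU φ z)
    (𝓔 := fun (z : ℂ) (y : (quasiSplit (↥(maximalRealSubfield L)) L (IsCMField.complexConj L) 2).Adelic) => Cφ * (borelHeight y : ℝ) ^ z.re) (K := (((standardMaximalCompactGL 2 L).comap (adelicVal ↥(maximalRealSubfield L) L (IsCMField.complexConj L) 2 ((StdForm.antidiagonal 2).over L)) : Subgroup (quasiSplit (↥(maximalRealSubfield L)) L (IsCMField.complexConj L) 2).Adelic) : Set (quasiSplit (↥(maximalRealSubfield L)) L (IsCMField.complexConj L) 2).Adelic)) (Z := Kc) (m := m)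
    hij hN hcδ hδ μ μ₁ μ₂ hKUc hU₀o h𝓔U (fun z hz k hk => (hN' z hz k hk).1) (fun z hz k hk => (hN' z hz k hk).2)
    (fun z hz k hk b => ⟨(hφarch z hz k hk b).1, fun j hj s => (hφarch z hz k hk b).2 j hj s⟩)
  exact exists_bound_sub_borelConstantTerm_level_cm_two_family L hij hN hcδ hδ ν h𝓕 h𝓕c μ μ₁ μ₂ χ hχ hKc1 hφc hφM hφB hf hU₀o hU₀K hφU hT hm hN₂
    hA hdecArch

/-- **`Λ^T E(f_z)` IS BOUNDED ON `U(J₂)(𝔸)` UNIFORMLY FOR `z` IN A COMPACT `Kc ⊂ {1 < Re z}`**, from the single archimedean binder `hφarch` — ★ (R6g-a)_two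
`exists_norm_truncation_eisensteinSeriesU_flatSectionU_le_uniform_cm_two` with its `hdec` DISCHARGED by (R3u): `∃ M, ∀ z ∈ Kc, ∀ g, ‖Λ^T E(f_z)(g)‖ ≤ M` (the `hΛ′bdd` of ★ (R6g-b)_two on
a neighbourhood, uniformly). [cite: MoeglinWaldspurger1995, I.2.13, IV.2] [cite: Arthur1980TraceFormulaII, §4] -/
theorem exists_norm_truncation_flatSectionU_le_uniform_level_cm_two_of_archSmooth {δ : L} (hcδ : IsCMField.complexConj L δ = -δ) (hδ : δ ≠ 0)
    (ν : Measure ↥(adelicUnipotent ↥(maximalRealSubfield L) L (IsCMField.complexConj L) 2)) [ν.IsHaarMeasure]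
    {𝓕 : Set ↥(adelicUnipotent ↥(maximalRealSubfield L) L (IsCMField.complexConj L) 2)} (h𝓕 : IsFundamentalDomain ↥(rationalUnipotent ↥(maximalRealSubfield L) L (IsCMField.complexConj L) 2) 𝓕 ν)
    (h𝓕c : IsCompact (closure 𝓕))
    (μ : Measure (AdeleRing (𝓞 ↥(maximalRealSubfield L)) ↥(maximalRealSubfield L))) [μ.IsAddHaarMeasure]
    (μ₁ : Measure (InfiniteAdeleRing ↥(maximalRealSubfield L))) [μ₁.IsAddHaarMeasure] (μ₂ : Measure (FiniteAdeleRing (𝓞 ↥(maximalRealSubfield L)) ↥(maximalRealSubfield L))) [μ₂.IsAddHaarMeasure]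
    (χ : HeckeCharacter L) (hχ : χ.IsUnitary) {Kc : Set ℂ} (hKc : IsCompact Kc) (hKc1 : ∀ z ∈ Kc, 1 < z.re)
    {φ : (quasiSplit (↥(maximalRealSubfield L)) L (IsCMField.complexConj L) 2).Adelic → ℂ} (hφc : Continuous φ) {Mφ : ℝ} (hφM : ∀ x, ‖φ x‖ ≤ Mφ)
    (hφB : ∀ b ∈ borelU ((IsCMField.complexConj L : L ≃ₐ[↥(maximalRealSubfield L)] L) : L →+* L) ((StdForm.antidiagonal 2).over L), ∀ x : (quasiSplit (↥(maximalRealSubfield L)) L (IsCMField.complexConj L) 2).Adelic, φ ((quasiSplit (↥(maximalRealSubfield L)) L (IsCMField.complexConj L) 2).toAdelic b * x) = φ x)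
    (hf : ∀ z ∈ Kc, ∀ (b g : (quasiSplit (↥(maximalRealSubfield L)) L (IsCMField.complexConj L) 2).Adelic) (u : (AdeleRing (𝓞 L) L)ˣ),
      ((b.1 : GL (Fin 2) (AdeleRing (𝓞 L) L)) : Matrix (Fin 2) (Fin 2) (AdeleRing (𝓞 L) L)) 1 0 = 0 →
      (u : (AdeleRing (𝓞 L) L)) = ((b.1 : GL (Fin 2) (AdeleRing (𝓞 L) L)) : Matrix (Fin 2) (Fin 2) (AdeleRing (𝓞 L) L)) 0 0 →
        flatSectionU φ z (b * g) = ((χ u : ℂˣ) : ℂ) * ((ideleNorm u : ℝ) : ℂ) ^ z * flatSectionU φ z g)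
    {U₀ : Subgroup (GL (Fin 2) (FiniteAdeleRing (𝓞 L) L))} (hU₀o : IsOpen (U₀ : Set (GL (Fin 2) (FiniteAdeleRing (𝓞 L) L))))
    (hU₀K : U₀ ≤ glFiniteIntegralLevel 2 L)
    (hφU : ∀ u : (quasiSplit (↥(maximalRealSubfield L)) L (IsCMField.complexConj L) 2).Adelic, adelicVal ↥(maximalRealSubfield L) L (IsCMField.complexConj L) 2 ((StdForm.antidiagonal 2).over L) u ∈ U₀.map (GLn.ofFinite 2 L) → ∀ y : (quasiSplit (↥(maximalRealSubfield L)) L (IsCMField.complexConj L) 2).Adelic, φ (y * u) = φ y)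
    {T : ℝ≥0} (hT : 1 ≤ T) {m : ℕ} (hm : (finrank ℚ ↥(maximalRealSubfield L) : ℝ) < m) {Cφ : ℝ} (hCφ : 0 ≤ Cφ)
    (hφarch : ∀ z ∈ Kc, ∀ k ∈ ((standardMaximalCompactGL 2 L).comap (adelicVal ↥(maximalRealSubfield L) L (IsCMField.complexConj L) 2 ((StdForm.antidiagonal 2).over L)) : Subgroup (quasiSplit (↥(maximalRealSubfield L)) L (IsCMField.complexConj L) 2).Adelic), ∀ b : FiniteAdeleRing (𝓞 ↥(maximalRealSubfield L)) ↥(maximalRealSubfield L),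
      ContDiff ℝ m ((fun a : InfiniteAdeleRing ↥(maximalRealSubfield L) => flatSectionU φ z (((quasiSplit (↥(maximalRealSubfield L)) L (IsCMField.complexConj L) 2).toAdelic (weylLongU ((IsCMField.complexConj L : L ≃ₐ[↥(maximalRealSubfield L)] L) : L →+* L) (rfl : ((StdForm.antidiagonal 2).over L) = ((StdForm.antidiagonal 2).over L)))) *
          ((middleRootUnipotent hij hN (Multiplicative.ofAdd (traceZeroLine ↥(maximalRealSubfield L) L (IsCMField.complexConj L) hcδ hδ ((a, b) : AdeleRing (𝓞 ↥(maximalRealSubfield L)) ↥(maximalRealSubfield L)))) : ↥(adelicUnipotent ↥(maximalRealSubfield L) L (IsCMField.complexConj L) 2)) : (quasiSplit (↥(maximalRealSubfield L)) L (IsCMField.complexConj L) 2).Adelic) * k)) ∘ (InfiniteAdeleRing.ringEquiv_mixedSpace ↥(maximalRealSubfield L)).symm) ∧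
      ∀ j : ℕ, j ≤ m → ∀ s : mixedSpace ↥(maximalRealSubfield L),
        ‖iteratedFDeriv ℝ j ((fun a : InfiniteAdeleRing ↥(maximalRealSubfield L) => flatSectionU φ z (((quasiSplit (↥(maximalRealSubfield L)) L (IsCMField.complexConj L) 2).toAdelic (weylLongU ((IsCMField.complexConj L : L ≃ₐ[↥(maximalRealSubfield L)] L) : L →+* L) (rfl : ((StdForm.antidiagonal 2).over L) = ((StdForm.antidiagonal 2).over L)))) *
          ((middleRootUnipotent hij hN (Multiplicative.ofAdd (traceZeroLine ↥(maximalRealSubfield L) L (IsCMField.complexConj L) hcδ hδ ((a, b) : AdeleRing (𝓞 ↥(maximalRealSubfield L)) ↥(maximalRealSubfield L)))) : ↥(adelicUnipotent ↥(maximalRealSubfield L) L (IsCMField.complexConj L) 2)) : (quasiSplit (↥(maximalRealSubfield L)) L (IsCMField.complexConj L) 2).Adelic) * k)) ∘ (InfiniteAdeleRing.ringEquiv_mixedSpace ↥(maximalRealSubfield L)).symm) s‖ ≤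
          Cφ * (borelHeight (((quasiSplit (↥(maximalRealSubfield L)) L (IsCMField.complexConj L) 2).toAdelic (weylLongU ((IsCMField.complexConj L : L ≃ₐ[↥(maximalRealSubfield L)] L) : L →+* L) (rfl : ((StdForm.antidiagonal 2).over L) = ((StdForm.antidiagonal 2).over L)))) *
          ((middleRootUnipotent hij hN (Multiplicative.ofAdd (traceZeroLine ↥(maximalRealSubfield L) L (IsCMField.complexConj L) hcδ hδ (((InfiniteAdeleRing.ringEquiv_mixedSpace ↥(maximalRealSubfield L)).symm s, b) : AdeleRing (𝓞 ↥(maximalRealSubfield L)) ↥(maximalRealSubfield L)))) : ↥(adelicUnipotent ↥(maximalRealSubfield L) L (IsCMField.complexConj L) 2)) : (quasiSplit (↥(maximalRealSubfield L)) L (IsCMField.complexConj L) 2).Adelic) * k) : ℝ) ^ z.re) :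
    ∃ M : ℝ, ∀ z ∈ Kc, ∀ g : (quasiSplit (↥(maximalRealSubfield L)) L (IsCMField.complexConj L) 2).Adelic, ‖truncation ν 𝓕 T (eisensteinSeriesU (flatSectionU φ z)) g‖ ≤ M := by
  obtain ⟨M₁, hdec⟩ := exists_bound_sub_borelConstantTerm_level_cm_two_uniform_of_archSmooth L hij hN hcδ hδ ν h𝓕 h𝓕c μ μ₁ μ₂ χ hχ hKc hKc1
    hφc hφM hφB hf hU₀o hU₀K hφU hT hm hCφ hφarch
  obtain ⟨M₀, h⟩ := exists_norm_truncation_eisensteinSeriesU_flatSectionU_le_uniform_cm_two L ν h𝓕 hT hKc hKc1 hφc hφM hφB hdec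
  exact ⟨max M₀ M₁, h⟩

end CM

end Summit.HodgeConjecture.HodgeConjecture.Cruxes.H413.K2E1EisensteinMinusConstantTermBoundedLevelCMTwoUniform

end
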